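import Literature.Barriers.CriticalPhenomena.GridSAWFormulaBundles
import HarnessLib

/-!
# The grid drawing of the graph of a formula, V: soundness of the Boolean congestion tests

What the decided checks of `GridSAWFormulaStampChecks.lean` mean for the points of the drawn
paths (`poly` of the corner lists, `GridSAWFormulaStampKit.lean`):

* `WithinB`, `within_bboxOf_of_mem`, `within_of_inCseg` — bounding boxes contain their points and
  the boxes spanned by two of them; `ne_of_boxApartB` — points of two apart boxes differ;
* `mem_csegs_of_infix` — consecutive corners are a listed segment;
* **`edgeEdge_sound`** — if `edgeEdgeB ws₁ ws₂ δ` holds then a point common to `poly ws₁` and the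
  translate of `poly ws₂` is an end point of `ws₁` that is also a translated end point of `ws₂`;
* **`ptEdge_sound`** — if `ptEdgeB p ws δ` holds and `p` lies on the translate of `poly ws` then
  `p` is a translated end point of `ws`;
* `endsOf_eq` — under `edgesWF`, the end points of the corner list of an edge are the local
  positions of its two end references; further table facts read off the generated data by
  `decide` (`tables_ok`: own references carry offset `0`, local coordinates lie in the box
  `[-10, 257] × [-27, 160]`, listed references are pairwise distinct, foreign references are cell
  vertices at one of five tile offsets, gadget vertex offsets are below `64`).

## References

* M. Liśkiewicz, M. Ogihara, S. Toda, TCS 304 (2003) 129–156, §4 (proof of Theorem 7).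
-/

namespace Literature.Barriers.CriticalPhenomena.GridSAW.FormulaDrawing

/-! ### Boxes -/

/-- A point lies in a box `(x₀, x₁, y₀, y₁)`. [folklore] -/
def WithinB (b : ℤ × ℤ × ℤ × ℤ) (p : GridPoint) : Prop :=
  b.1 ≤ p.1 ∧ p.1 ≤ b.2.1 ∧ b.2.2.1 ≤ p.2 ∧ p.2 ≤ b.2.2.2

/-- The fold computing `bboxOf` only enlarges the box and ends up containing every element.
[folklore] -/
theorem within_foldl_bbox (l : List GridPoint) (b₀ : ℤ × ℤ × ℤ × ℤ) :
    let b := l.foldl (fun b p => (min b.1 p.1, max b.2.1 p.1, min b.2.2.1 p.2, max b.2.2.2 p.2)) b₀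
    (b.1 ≤ b₀.1 ∧ b₀.2.1 ≤ b.2.1 ∧ b.2.2.1 ≤ b₀.2.2.1 ∧ b₀.2.2.2 ≤ b.2.2.2) ∧ ∀ p ∈ l, WithinB b p := by
  induction l generalizing b₀ with
  | nil => simp
  | cons q l ih =>
    simp only [List.foldl_cons, List.mem_cons]
    obtain ⟨h1, h2⟩ := ih (min b₀.1 q.1, max b₀.2.1 q.1, min b₀.2.2.1 q.2, max b₀.2.2.2 q.2)
    simp only at h1
    refine ⟨⟨?_, ?_, ?_, ?_⟩, fun p hp => ?_⟩
    · exact h1.1.trans (min_le_left _ _)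
    · exact (le_max_left _ _).trans h1.2.1
    · exact h1.2.2.1.trans (min_le_left _ _)
    · exact (le_max_left _ _).trans h1.2.2.2
    · rcases hp with rfl | hp
      · exact ⟨h1.1.trans (min_le_right _ _), (le_max_right _ _).trans h1.2.1,
          h1.2.2.1.trans (min_le_right _ _), (le_max_right _ _).trans h1.2.2.2⟩
      · exact h2 p hp

/-- **Every listed point lies in the bounding box.** [folklore] -/
theorem within_bboxOf_of_mem {l : List GridPoint} {p : GridPoint} (hp : p ∈ l) : WithinB (bboxOf l) p :=
  (within_foldl_bbox l _).2 p hp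

/-- The box spanned by two points of a box lies in the box. [folklore] -/
theorem within_of_inCseg {b : ℤ × ℤ × ℤ × ℤ} {a c p : GridPoint} (ha : WithinB b a) (hc : WithinB b c)
    (h : inCseg a c p = true) : WithinB b p := by
  rw [inCseg_iff] at h
  unfold WithinB at *
  omega

/-- Points of apart boxes differ (the second box translated by `δ`). [folklore] -/
theorem ne_of_boxApartB {b₁ b₂ : ℤ × ℤ × ℤ × ℤ} {δ : GridPoint} (h : boxApartB b₁ b₂ δ = true)
    {p q : GridPoint} (hp : WithinB b₁ p) (hq : WithinB b₂ q) : p ≠ shiftPt δ q := by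
  intro hpq
  simp only [boxApartB, Bool.or_eq_true, decide_eq_true_eq] at h
  unfold WithinB at hp hq
  rw [hpq] at hp
  simp only [shiftPt] at hp
  omega

/-- Translation commutes with the spanned box. [folklore] -/
theorem inCseg_shiftPt {a b p : GridPoint} (δ : GridPoint) (h : inCseg a b p = true) :
    inCseg (shiftPt δ a) (shiftPt δ b) (shiftPt δ p) = true := by
  rw [inCseg_iff] at h ⊢
  simp only [shiftPt]
  omega

/-! ### Segments of corner lists -/

/-- Consecutive corners are a listed segment. [folklore] -/
theorem mem_csegs_of_infix {ws : List GridPoint} {a b : GridPoint} (h : [a, b] <:+: ws) : (a, b) ∈ csegs ws := by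
  obtain ⟨s, t, rfl⟩ := h
  induction s with
  | nil => simp [csegs]
  | cons x s ih =>
    have hl : s ++ [a, b] ++ t ≠ [] := by simp
    obtain ⟨y, r, hyr⟩ := List.exists_cons_of_ne_nil hl
    have e1 : x :: s ++ [a, b] ++ t = x :: (s ++ [a, b] ++ t) := by simp
    rw [e1]
    rw [hyr] at ih ⊢
    simp only [csegs, List.drop_succ_cons, List.drop_zero, List.zip_cons_cons, List.mem_cons] at ih ⊢
    exact Or.inr ih

/-- The corners of a list lie in its bounding box, hence so do the points of `poly`. [folklore] -/
theorem within_bboxOf_of_mem_poly {ws : List GridPoint} {p : GridPoint} (hp : p ∈ poly ws) : WithinB (bboxOf ws) p := by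
  rcases mem_poly_exists hp with ⟨a, b, hab, hin⟩ | rfl
  · have ha : a ∈ ws := hab.subset (by simp)
    have hb : b ∈ ws := hab.subset (by simp)
    exact within_of_inCseg (within_bboxOf_of_mem ha) (within_bboxOf_of_mem hb) hin
  · exact within_bboxOf_of_mem (List.mem_singleton_self p)

/-- `poly` of a list with at least two corners, pointwise on segments. [folklore] -/
theorem exists_cseg_of_mem_poly {ws : List GridPoint} (hws : 2 ≤ ws.length) {p : GridPoint} (hp : p ∈ poly ws) :
    ∃ s ∈ csegs ws, inCseg s.1 s.2 p = true := by
  rcases mem_poly_exists hp with ⟨a, b, hab, hin⟩ | h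
  · exact ⟨(a, b), mem_csegs_of_infix hab, hin⟩
  · rw [h] at hws; simp at hws

/-! ### Soundness of the two congestion tests -/

/-- **Soundness of `edgeEdgeB`.** [folklore] -/
theorem edgeEdge_sound {ws₁ ws₂ : List GridPoint} {δ : GridPoint} (h : edgeEdgeB ws₁ ws₂ δ = true)
    (h₁ : 2 ≤ ws₁.length) (h₂ : 2 ≤ ws₂.length) {p q : GridPoint} (hp : p ∈ poly ws₁) (hq : q ∈ poly ws₂)
    (hpq : p = shiftPt δ q) : p ∈ endsOf ws₁ ∧ p ∈ (endsOf ws₂).map (shiftPt δ) := by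
  unfold edgeEdgeB at h
  simp only [Bool.or_eq_true] at h
  rcases h with h | h
  · exact absurd hpq (ne_of_boxApartB h (within_bboxOf_of_mem_poly hp) (within_bboxOf_of_mem_poly hq))
  · simp only [List.all_eq_true] at h
    obtain ⟨s, hs, hps⟩ := exists_cseg_of_mem_poly h₁ hp
    obtain ⟨t, ht, hqt⟩ := exists_cseg_of_mem_poly h₂ hq
    have hmeet := h s hs t ht
    have hp' : inCseg (shiftPt δ t.1) (shiftPt δ t.2) p = true := by rw [hpq]; exact inCseg_shiftPt δ hqt
    have hmem := csegMeet_sub hmeet hps hp'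
    simp only [List.mem_filter, List.contains_iff_mem] at hmem
    exact ⟨hmem.1, hmem.2⟩

/-- **Soundness of `ptEdgeB`.** [folklore] -/
theorem ptEdge_sound {p : GridPoint} {ws : List GridPoint} {δ : GridPoint} (h : ptEdgeB p ws δ = true)
    (hws : 2 ≤ ws.length) {q : GridPoint} (hq : q ∈ poly ws) (hpq : p = shiftPt δ q) :
    p ∈ (endsOf ws).map (shiftPt δ) := by
  unfold ptEdgeB at h
  simp only [Bool.or_eq_true] at h
  rcases h with h | h
  · refine absurd hpq (ne_of_boxApartB h ?_ (within_bboxOf_of_mem_poly hq))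
    unfold WithinB; simp
  · simp only [List.all_eq_true] at h
    obtain ⟨t, ht, hqt⟩ := exists_cseg_of_mem_poly hws hq
    have hp' : inCseg (shiftPt δ t.1) (shiftPt δ t.2) p = true := by rw [hpq]; exact inCseg_shiftPt δ hqt
    exact csegMeet_sub (h t ht) (inCseg_left p p) hp'

/-- The end points of a corner list with given head and last. [folklore] -/
theorem endsOf_eq {ws : List GridPoint} {a b : GridPoint} (ha : ws.head? = some a) (hb : ws.getLast? = some b) :
    endsOf ws = [a, b] := by
  simp [endsOf, ha, hb]

/-- The points of `poly` with given head: the head of `poly ws` is the head of `ws`. [folklore] -/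
theorem head?_poly (ws : List GridPoint) : (poly ws).head? = ws.head? := by
  cases ws <;> rfl

/-! ### Facts read off the tables -/


namespace Kind

/-- The own references of a kind. [folklore] -/
def ownKeys (κ : Kind) : List Ref := (verts κ).map Prod.fst

/-- **Sanity of the tables** of a kind: own references carry offset `0` and small indices, listed
references are pairwise distinct, foreign references are cell vertices at one of the five offsets
`(0,0), (0,-1), (-1,0), (0,1), (0,2)`, every local coordinate lies in `[-10, 257] × [-27, 160]`.
[folklore] -/
def tableOK (κ : Kind) : Bool :=
  ((verts κ).all fun a => decide (a.1.offset = (0, 0)) &&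
    (match a.1 with | .cell _ _ c l => decide (c ≤ 2 ∧ l ≤ 16) | .gad _ _ f idx => decide (f ≤ 7 ∧ idx < 64))) &&
  decide (((posTable κ).map Prod.fst).Nodup) &&
  ((phantoms κ).all fun a => a.1.isCell && decide (a.1.offset ∈ [(0, 0), (0, -1), (-1, 0), (0, 1), (0, 2)]) &&
    (match a.1 with | .cell _ _ c l => decide (c ≤ 2 ∧ l ≤ 16) | .gad .. => false)) &&
  (((posTable κ).map Prod.snd ++ (wedges κ).flatMap fun e => e.2.2).all (inBoxB (-10) 257 (-27) 160))

end Kind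

/-- **The tables of every kind are sane.** [folklore] -/
theorem tables_ok (κ : Kind) : κ.tableOK = true := by
  cases κ <;> decide +kernel

/-- **The edge lists of the kinds have no repeated entries.** [folklore] -/
theorem wedges_nodup_all (κ : Kind) : (Kind.wedges κ).Nodup := by
  cases κ <;> decide +kernel

/-! ### Corridors of the return paths and bounds of the picture (decided) -/

namespace Kind

/-- The listed local positions and all corners of the paths of a kind. [folklore] -/
def cornersAndPos (κ : Kind) : List GridPoint := (posTable κ).map Prod.snd ++ (wedges κ).flatMap fun e => e.2.2

/-- The segments (consecutive corner pairs) of all paths of a kind. [folklore] -/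
def allSegs (κ : Kind) : List (GridPoint × GridPoint) := (wedges κ).flatMap fun e => csegs e.2.2

end Kind

/-- The closed box of a corner pair meets the region `{(x, y₀) | x < X}`. [folklore] -/
def segHitsB (y₀ X : ℤ) (s : GridPoint × GridPoint) : Bool :=
  decide (min s.1.2 s.2.2 ≤ y₀) && decide (y₀ ≤ max s.1.2 s.2.2) && decide (min s.1.1 s.2.1 < X)

namespace BSpec

/-- Has a neighbour to the east (doubler: the first tile). [folklore] -/
def eastish : BSpec → Bool
  | tile _ _ e _ => e
  | clause _ _ _ e => e
  | doubler => true

/-- Heads a three-literal clause (its OR-gadget spans two more columns). [folklore] -/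
def or3head : BSpec → Bool
  | clause _ _ r e => decide (r = .or3a) && e
  | _ => false

/-- Receives a return path or the doubler's connector from the west along the base line: tiles
without a west neighbour and clause-row tiles. [folklore] -/
def westOpen : BSpec → Bool
  | tile _ w _ _ => !w
  | clause .. => true
  | doubler => false

/-- A tile-row tile. [folklore] -/
def isTile : BSpec → Bool
  | tile .. => true
  | _ => false

/-- A clause-row tile. [folklore] -/
def isClause : BSpec → Bool
  | clause .. => true
  | _ => false

end BSpec

/-- **Horizontal and vertical extent of the kinds of a bundle**: abscissae at most `107`, or `224`
with an east neighbour, or `341` for the head of a three-literal clause; at least `-10`, and at least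
`85` in the doubler's tile; ordinates at least `-27`, and at least `-10` in the clause row.
[folklore] -/
theorem extent_bundle :
    (BSpec.all.all fun b => b.bundle.all fun κ => κ.cornersAndPos.all fun p =>
      (decide (p.1 ≤ 107) || (b.eastish && decide (p.1 ≤ 224)) || (b.or3head && decide (p.1 ≤ 341))) &&
      decide (-10 ≤ p.1) && (!decide (b = .doubler) || decide (85 ≤ p.1)) &&
      decide (-27 ≤ p.2) && (!b.isClause || decide (-10 ≤ p.2)) && decide (p.2 ≤ 160)) = true := by
  decide +kernel

/-- **The west corridor is free**: in a tile open to the west, no listed position and no path meets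
`{(x, 0) | x < 15}`. [folklore] -/
theorem westCorridor_bundle :
    (BSpec.all.all fun b => !b.westOpen || b.bundle.all fun κ =>
      (κ.posTable.all fun a => !(decide (a.2.2 = 0) && decide (a.2.1 < 15))) &&
      (κ.allSegs.all fun s => !segHitsB 0 15 s)) = true := by
  decide +kernel

/-- **Nothing at the top-left corner**: no listed position and no path of any kind meets
`{(x, 160) | x < 15}`. [folklore] -/
theorem topCorridor_all (κ : Kind) :
    ((κ.posTable.all fun a => !(decide (a.2.2 = 160) && decide (a.2.1 < 15))) &&
      (κ.allSegs.all fun s => !segHitsB 160 15 s)) = true := by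
  cases κ <;> decide +kernel

/-- A connector reference (`l = 0`) and a corner-`Q` reference (`l = 4`) of an edge. [folklore] -/
def connQSameRowB (r₁ r₂ : Ref) : Bool :=
  match r₁, r₂ with
  | .cell di _ _ 0, .cell di' _ _ 4 => decide (di = di')
  | _, _ => true

/-- **Edges between a connector and a corner `Q` stay in one row.** [folklore] -/
theorem connQ_all (κ : Kind) : (κ.wedges.all fun e => connQSameRowB e.1 e.2.1 && connQSameRowB e.2.1 e.1) = true := by
  cases κ <;> decide +kernel

/-- **The ends of the return paths are listed**: every tile-row bundle has a kind owning the corner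
`Q = (cell 0 0 2 4)` at `(107, 0)`, every tile-row or clause-row bundle a kind owning the connector
`(cell 0 0 0 0)` at `(15, 0)`. [folklore] -/
theorem retEnds_bundle :
    (BSpec.all.all fun b =>
      (!b.isTile || b.bundle.any fun κ => κ.verts.contains (.cell 0 0 2 4, ((107 : ℤ), (0 : ℤ)))) &&
      (!(b.isTile || b.isClause) || b.bundle.any fun κ => κ.verts.contains (.cell 0 0 0 0, ((15 : ℤ), (0 : ℤ))))) = true := by
  decide +kernel

/-! ### The blanket degree bound (decided) -/

namespace Kind

/-- The end references of the edges of a kind (with multiplicity). [folklore] -/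
def endRefs (κ : Kind) : List Ref := (wedges κ).map (fun e => e.1) ++ (wedges κ).map (fun e => e.2.1)

/-- The number of edge ends of a kind at a reference. [folklore] -/
def endCnt (κ : Kind) (r : Ref) : ℕ := (endRefs κ).count r

/-- The same, after the cheap test that a foreign reference is a listed foreign key. [folklore] -/
def endCnt' (κ : Kind) (r : Ref) : ℕ :=
  if r.offset = (0, 0) || (phantoms κ).any (fun q => q.1 == r) then κ.endCnt r else 0

end Kind

/-- The tile offsets from which an object may refer to an own cell vertex of column class `c`:
connectors and OR-gadgets from the west to `c = 0`, column and landing cables from below to `c = 1`,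
row cables from the east to `c = 2`. [folklore] -/
def Ref.nbrDeltas : Ref → List (ℤ × ℤ)
  | .cell di dj c _ =>
    if di = 0 ∧ dj = 0 then (if c = 0 then [(0, -1), (0, -2)] else if c = 1 then [(1, 0)] else if c = 2 then [(0, 1)] else [])
    else []
  | .gad .. => []

/-- **Foreign keys fall in the neighbour classes.** [folklore] -/
theorem phantomClass_all (κ : Kind) :
    ((Kind.phantoms κ).all fun q => match q.1 with
      | .cell di dj c l => decide ((di, dj) = (0, 0)) || decide ((-di, -dj) ∈ Ref.nbrDeltas (.cell 0 0 c l))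
      | .gad .. => false) = true := by
  cases κ <;> decide +kernel

namespace BSpec

/-- The number of edge ends of the kinds of a bundle at a reference. [folklore] -/
def bundleCnt (b : BSpec) (r : Ref) : ℕ := (b.bundle.map fun κ => κ.endCnt' r).sum

/-- The largest number of edge ends at the own reference `r` of a tile, over the realisable bundles
of the neighbour at offset `Δ`. [folklore] -/
def nbrMax (b : BSpec) (Δ : ℤ × ℤ) (r : Ref) : ℕ :=
  BSpec.all.foldr (fun b' m => if realizable b b' Δ then max (b'.bundleCnt (Kind.reRef (-Δ.1, -Δ.2) r)) m else m) 0

/-- Return-path ends at an own reference: the corner `Q` of the last cell of a tile row, the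
connector of the first cell of a row. [folklore] -/
def retCnt (b : BSpec) (r : Ref) : ℕ :=
  (match b, r with
    | .tile _ _ e _, .cell di dj c l => if di = 0 ∧ dj = 0 ∧ c = 2 ∧ l = 4 ∧ e = false then 1 else 0
    | _, _ => 0) +
  (match b, r with
    | .tile _ w _ _, .cell di dj c l => if di = 0 ∧ dj = 0 ∧ c = 0 ∧ l = 0 ∧ w = false then 1 else 0
    | .clause .., .cell di dj c l => if di = 0 ∧ dj = 0 ∧ c = 0 ∧ l = 0 then 1 else 0
    | _, _ => 0)

/-- **The blanket degree bound of a bundle**: at every own vertex, own edge ends plus the worst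
realisable neighbours' edge ends plus return-path ends number at most three. [folklore] -/
def degOKB (b : BSpec) : Bool :=
  b.bundle.all fun κ => κ.verts.all fun a =>
    decide (b.bundleCnt a.1 + ((a.1.nbrDeltas.map fun Δ => b.nbrMax Δ a.1).sum) + b.retCnt a.1 ≤ 3)

end BSpec

set_option maxHeartbeats 40000000 in
/-- **The blanket degree bound holds for every bundle.** [folklore] -/
theorem degree_bundle : BSpec.all.all BSpec.degOKB = true := by
  decide +kernel

end Literature.Barriers.CriticalPhenomena.GridSAW.FormulaDrawing
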